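import Summits.BirchSwinnertonDyer.Rank1Residual.JET.D1IndexRecordsKit
import HarnessLib

/-!
# Good supersingular class X7 (cell O4, `r_an = 1`) and friends: the KIT of the per-pair HEEGNER-INDEX
# records with `ρ̄_{E,p}` onto supplied BY NAME — Jetchev 2008 Cor. 1.5 (Tamagawa line, one `TamLocal` or one
# exact `TamX` certificate) and Kolyvagin's unit line, at ANY odd good prime `p` (so also `p = 3`)

HONEST FRAMING (cell `b2b-bsdres`, run/shared/lean/b2b/bsd-rank1-residual/, verbatim in every
file): the goal of the cell is to DELETE the COMBINATION-SHAPED residual classes of the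
Birch–Swinnerton-Dyer formula for ALL analytic-rank `≤ 1` elliptic curves over `ℚ` — "full BSD
formula for every rank `≤ 1` curve in class `C`" assembled STRICTLY from published theorems — so
that the rank-`≤ 1` remainder becomes exactly the CONSTRUCTION-SHAPED classes, which are TYPED
(missing-input `Prop`s), NOT attempted. This is not "finishing BSD". Prove what is provable now;
shrink each hard class to its core with data; no claim beyond stated classes. This file is a TOOL:
theorems only (no definition, no named fact, no `sorry`); PER PAIR; nothing is booked here; nothing
about any particular curve is asserted; X6 / X7 / X8 stay CONSTRUCTION-SHAPED. Unit `b2b-bsdres-x10b`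
GEN 31 (prover A of the supersingular pair; PREREG `HOME/b2b-bsdres-x10b/gen31/PREREG-JETSS-G31.md`).

WHAT THIS FILE IS — the twin of cell `bsd-jet`'s D1 kit `JET.bsdp_of_d1IndexRow_tam_min` /
`JET.bsdp_of_d1IndexRow_unit_min` (`JET/D1IndexRecordsKit.lean`, seat `bsd-jet-ty`) with ONE change: the
surjectivity of `ρ̄_{E,p}` is an explicit HYPOTHESIS `hρ` instead of three Serre Prop-19 witnesses, so
that a record can discharge it BY NAME with an already landed kernel certificate (the cell's
`Supersingular.surj_x7r1_<label>_<p>` of `RankOneSurjCertificatesX7_*.lean` (`p ≥ 5`, Serre Prop. 19) and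
`RankOneSurjThreeCertificates_*.lean` (`p = 3`, prover B's `surj_three_of_ainvs_of_irr_of_order`), additive-p3
GEN 20) and so that `p = 3` is served (the Serre-witness road of the D1 kit needs `p ≥ 5`; the consumers do
not: Jetchev 2008 Cor. 1.5 = `Jetchev2008.cor15_padicValNat_card_primaryComponent_sha_le` carries `p ≠ 2`,
`p ∤ N`, `ρ̄` onto; Kolyvagin's unit line `Typed.bsdp_of_kolyvagin_of_not_dvd_index` carries `p ≠ 2`, `ρ̄`
onto). Everything else is the D1 kit verbatim: for a literal integer model, `IsElliptic` from `Δ ≠ 0`,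
minimality SUPPLIED on the Jetchev lines (`hmin`, any tree criterion; the unit line needs none), good reduction at `p` read off the minimal model as
`p ∤ Δ` (`WeierstrassCurve.hasGoodReductionAtPrime_of_not_dvd`) hence `p ∤ N` for the level of the
Heegner datum (`Supersingular.not_dvd_level_of_isHeegnerPoint_of_good`), and — Tamagawa line only — the
Tamagawa half `c_q(W/ℚ_q) = c` IN THE KERNEL from ONE stage-1 certificate `TamLocal` with a singleton
value set (multiplicative `q`, or Kodaira `II`, `III`, `III*`, `II*`; n1011-p03's bridge
`Additive.IntModelTam.localTamagawaNumber_padic_eq_of_intModel_of_tamLocal`) or from ONE exact certificate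
`TamX` (Kodaira `IV` / `IV*`: `c = 3` by a root witness, `1` by exhaustion;
`Additive.IntModelTam.localTamagawaNumber_padic_eq_of_intModel_of_tamX`), and `w ≤ ord_p c`. Displayed
binders exactly as in every Heegner-index record of the tree: the PUBLISHED facts `hJ` / `hB`, Kolyvagin's
finiteness `hKo`, GZK `hGZK`; the Heegner datum (`K` imaginary quadratic — `d_K ≠ −3` on the Jetchev line —
with the Heegner hypothesis for the level `N`, `P = y_K` of infinite order); the optimal-parametrisation
datum `hopt` (Jetchev line only; Cremona optimality of the class representative, of record); `q ∣ N`; the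
INDEX LINE `hv : ord_p [E(K):ℤP] ≤ w` / `hI : ¬ p ∣ [E(K):ℤP]` — the two-engine datum (cell `bsd-jet`'s
engine A `jetA.gp` / engine B `jetB.py`, byte-identical), NEVER a kernel computation; `r_an ≤ 1`;
`#Ш_an = s` with `ord_p s = 0`. Population of record for this unit: the X7 rank-one REM13-ONLY cells of
Tamagawa shape T / U (`HOME/b2b-bsdres-x10b/gen31/JETSS-RUNLIST-g31.tsv`); what such a record is worth
(tier) is referee A's ruling, not this file's.

* `bsdp_of_indexRow_tam_of_surj` — Jetchev Tamagawa line, `TamLocal` certificate (singleton value set).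
* `bsdp_of_indexRow_tamX_of_surj` — Jetchev Tamagawa line, exact `TamX` certificate (Kodaira `IV` / `IV*`).
* `bsdp_of_indexRow_unit_of_surj` — Kolyvagin unit line (`p ∤ [E(K):ℤy_K]`; McCallum 1991 §1 / Gross 1991
  Prop. 2.1 (2) as the PUBLISHED fact `Kolyvagin1990_padicValNat_card_sha_le N W K`; no Tamagawa half, no
  optimality datum, no `d_K ≠ −3`, no minimality).

References: D. Jetchev, *Global divisibility of Heegner points and Tamagawa numbers*, Compos. Math. 144
(2008) 811–826, Hypothesis (∗), Cor. 1.5 [Jetchev2008]; V. A. Kolyvagin, *Euler systems* (1990) Thm. A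
[KolyvaginEulerSystems1990]; B. H. Gross, LMS LN 153 (1991) Thm. 1.3, Prop. 2.1 [GrossLMS1991];
W. G. McCallum, LMS LN 153 (1991) §1 Theorem, p. 296 [McCallumLMS1991]; R. L. Miller, LMS J. Comput. Math.
14 (2011) Def. 1.1, Thm. 4.1, Cor. 4.8 [Miller2011LMS]; J. H. Silverman, *AEC* (2009) VII.1 Rem. 1.1, VII.5
Prop. 5.1 [SilvermanAEC2009]; J. H. Silverman, *Advanced Topics* (1994) IV.9.4 [SilvermanATAEC1994];
F. Diamond, J. Shurman, GTM 228, Prop. 5.8.5 / (8.44) [DiamondShurman2005].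
-/

set_option autoImplicit false

noncomputable section

open scoped Classical

open WeierstrassCurve Literature.NumberTheory.EllipticCurves
  Literature.NumberTheory.EllipticCurves.ModularForms
  Literature.NumberTheory.EllipticCurves.Rank1Residual
  Literature.NumberTheory.EllipticCurves.Rank1Residual.Typed
  Literature.NumberTheory.EllipticCurves.Rank1Residual.X11RankOneCertificates
  Summit.BirchSwinnertonDyer.BirchSwinnertonDyer.Rank1Residual
  Summit.BirchSwinnertonDyer.BirchSwinnertonDyer.Rank1Residual.IntModel
  Summit.BirchSwinnertonDyer.BirchSwinnertonDyer.Rank1Residual.X11RankOne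
  Summit.BirchSwinnertonDyer.BirchSwinnertonDyer.Rank2Observatory.Tam

namespace Summit.BirchSwinnertonDyer.Rank1Residual.Supersingular.JetBySurj

/-- **`BSD(E,p)` at an odd GOOD prime `p` for a literal integer model from the two-engine HEEGNER-INDEX line
`ord_p [E(K):ℤy_K] ≤ w` through Jetchev 2008 Cor. 1.5 (inside its Hypothesis (∗)), with `ρ̄_{E,p}` onto
SUPPLIED BY NAME (`hρ`), good reduction at `p` and the Tamagawa exponent `w ≤ ord_p c_q(E)` CHECKED IN THE
KERNEL from ONE stage-1 `TamLocal` certificate with singleton value set.** Inputs: (kernel, `decide` goals for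
a record) `hmin` global minimality of the literal model (any tree criterion); `p ∤ Δ` (good reduction at `p`
⇒ `p ∤ N` for the level of the Heegner datum); `T : TamLocal` at `q = T.p` with `T.check = true` and
`T.vals = [c]` (⇒ `c_q(W/ℚ_q) = c`) and `w ≤ ord_p c`; (by name) `hρ`; (binders, displayed) Jetchev 2008 Cor.
1.5 `hJ` (PUBLISHED), Kolyvagin's finiteness `hKo`, GZK `hGZK`, the Heegner datum `K` (`d_K ≠ −3`, Heegner
hypothesis for `N`), the optimal-parametrisation datum `hopt`, `P = y_K` of infinite order, `q ∣ N`, the INDEX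
LINE `hv : ord_p [E(K):ℤP] ≤ w`, `r_an ≤ 1`, `#Ш_an = s` with `ord_p s = 0`. Output:
`Supersingular.bsdp_of_jetchevTamagawaCertificate`. The D1 kit `JET.bsdp_of_d1IndexRow_tam_min` with the
three Serre witnesses replaced by `hρ` and `5 ≤ p` by `p ≠ 2`. Per pair; no class statement; nothing about
any particular curve is asserted. [cite: Jetchev2008, Hypothesis (*) and Cor. 1.5 (p. 3)]
[cite: SilvermanAEC2009, VII.1 Remark 1.1 and VII.5 Prop. 5.1(a)] [cite: SilvermanATAEC1994, IV.9.4 and Cor. IV.9.2(d)]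
[cite: GrossLMS1991, §1 Thm. 1.3] [cite: Miller2011LMS, §1 Def. 1.1, Thm. 4.1 and Cor. 4.8]
[cite: DiamondShurman2005, Prop. 5.8.5 and (8.44)] -/
theorem bsdp_of_indexRow_tam_of_surj (p : ℕ) (hp : p.Prime) (hp2 : p ≠ 2) (a1 a2 a3 a4 a6 : ℤ)
    (hmin : (⟨a1, a2, a3, a4, a6⟩ : WeierstrassCurve ℚ).IsGloballyMinimal)
    (hpΔ : ¬ (p : ℤ) ∣ discOf [a1, a2, a3, a4, a6])
    (hρ : (⟨a1, a2, a3, a4, a6⟩ : WeierstrassCurve ℚ).HasSurjectiveModNGaloisRep p)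
    (q : ℕ) (T : TamLocal) (hTq : T.p = q) (hT : T.check ⟨a1, a2, a3, a4, a6⟩ = true)
    {c : ℕ} (hvals : T.vals = [c]) {w : ℕ} (hw : w ≤ padicValNat p c)
    (hJ : Jetchev2008.cor15_padicValNat_card_primaryComponent_sha_le)
    (hGZK : rank_eq_analyticRank_of_analyticRank_le_one)
    (W : WeierstrassCurve ℚ) (hW : W = ⟨a1, a2, a3, a4, a6⟩)
    {N : ℕ} [NeZero N] {K : Type} [Field K] [NumberField K] (hKo : kolyvagin N W K)
    (hK : IsImaginaryQuadratic K) (hD3 : NumberField.discr K ≠ -3)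
    (hH : SatisfiesHeegnerHypothesis N K)
    (hopt : ∃ Dt : ModularParametrizationData W N,
      ∀ z ∈ Dt.L.lattice, ∃ w ∈ periodLattice Dt.f, z = (Dt.c : ℂ) * w)
    {P : (W.baseChange K).toAffine.Point} (hP : IsHeegnerPoint N W K P) (hnt : ¬ IsOfFinAddOrder P)
    (hqN : q ∣ N) (hv : padicValNat p (AddSubgroup.zmultiples P).index ≤ w)
    (hr : W.analyticRank ≤ 1) {s : ℚ} (hs : shaAn W = (s : ℂ)) (hvs : padicValRat p s = 0) :
    BSDp W p := by
  subst hW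
  have h0 : discOf [a1, a2, a3, a4, a6] ≠ 0 := fun h ↦ hpΔ (by rw [h]; exact dvd_zero _)
  haveI hE : (⟨a1, a2, a3, a4, a6⟩ : WeierstrassCurve ℚ).IsElliptic :=
    X11b.isElliptic_of_discOf_ne_zero a1 a2 a3 a4 a6 h0
  haveI := hmin
  haveI : Fact (Nat.Prime p) := ⟨hp⟩
  haveI : Fact (Nat.Prime q) := ⟨hTq ▸ (TamLocal.check_common hT).1⟩
  have hI0 : integralModelInt (⟨a1, a2, a3, a4, a6⟩ : WeierstrassCurve ℚ) = ⟨a1, a2, a3, a4, a6⟩ :=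
    integralModelInt_eq_of_map_eq _ (map_mk_int a1 a2 a3 a4 a6)
  -- good reduction at `p` (minimal model, `p ∤ Δ`), hence `p ∤ N` for the level of the Heegner datum
  have hgood : (⟨a1, a2, a3, a4, a6⟩ : WeierstrassCurve ℚ).HasGoodReductionAtPrime p :=
    hasGoodReductionAtPrime_of_not_dvd _ p (by rw [minimalDiscriminantInt_eq hI0, intCurve_Δ]; exact hpΔ)
  have hpN : ¬ p ∣ N := Supersingular.not_dvd_level_of_isHeegnerPoint_of_good _ p hP hgood
  -- the Tamagawa half in the kernel: `c_q(W/ℚ_q) = c`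
  have hcq : ((⟨a1, a2, a3, a4, a6⟩ : WeierstrassCurve ℚ).baseChange ℚ_[q]).localTamagawaNumber ℤ_[q] = c :=
    Additive.IntModelTam.localTamagawaNumber_padic_eq_of_intModel_of_tamLocal hI0 q hTq hT hvals
  have hI : padicValNat p (AddSubgroup.zmultiples P).index ≤
      padicValNat p (((⟨a1, a2, a3, a4, a6⟩ : WeierstrassCurve ℚ).baseChange ℚ_[q]).localTamagawaNumber
        ℤ_[q]) := by
    rw [hcq]; exact hv.trans hw
  exact Supersingular.bsdp_of_jetchevTamagawaCertificate _ p hKo hJ hGZK hK hD3 hH hopt hP hnt hp2 hpN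
    hρ q hqN hI hr hs hvs

/-- **`BSD(E,p)` at an odd GOOD prime `p` for a literal integer model from the two-engine HEEGNER-INDEX line
through Jetchev 2008 Cor. 1.5, `ρ̄_{E,p}` onto BY NAME, the Tamagawa half from ONE EXACT `TamX` certificate**
(Kodaira type `IV` / `IV*` at the stringent prime `q`: `c_q = 3` by a root witness of Tate's quadratic, `1` by
exhaustion — n1011-p03's bridge `Additive.IntModelTam.localTamagawaNumber_padic_eq_of_intModel_of_tamX`).
As `bsdp_of_indexRow_tam_of_surj` with `F : TamX`, `F.p = q` prime, `F.check = true` and `w ≤ ord_p F.c`.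
Per pair; no class statement; nothing about any particular curve is asserted.
[cite: Jetchev2008, Hypothesis (*) and Cor. 1.5 (p. 3)] [cite: SilvermanATAEC1994, IV.9.4 Steps 5, 8]
[cite: SilvermanAEC2009, VII.1 Remark 1.1 and VII.5 Prop. 5.1(a)] [cite: GrossLMS1991, §1 Thm. 1.3]
[cite: Miller2011LMS, §1 Def. 1.1, Thm. 4.1 and Cor. 4.8] [cite: DiamondShurman2005, Prop. 5.8.5 and (8.44)] -/
theorem bsdp_of_indexRow_tamX_of_surj (p : ℕ) (hp : p.Prime) (hp2 : p ≠ 2) (a1 a2 a3 a4 a6 : ℤ)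
    (hmin : (⟨a1, a2, a3, a4, a6⟩ : WeierstrassCurve ℚ).IsGloballyMinimal)
    (hpΔ : ¬ (p : ℤ) ∣ discOf [a1, a2, a3, a4, a6])
    (hρ : (⟨a1, a2, a3, a4, a6⟩ : WeierstrassCurve ℚ).HasSurjectiveModNGaloisRep p)
    (q : ℕ) (hq : q.Prime) (F : TamX) (hFq : F.p = q) (hF : F.check ⟨a1, a2, a3, a4, a6⟩ = true)
    {w : ℕ} (hw : w ≤ padicValNat p F.c)
    (hJ : Jetchev2008.cor15_padicValNat_card_primaryComponent_sha_le)
    (hGZK : rank_eq_analyticRank_of_analyticRank_le_one)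
    (W : WeierstrassCurve ℚ) (hW : W = ⟨a1, a2, a3, a4, a6⟩)
    {N : ℕ} [NeZero N] {K : Type} [Field K] [NumberField K] (hKo : kolyvagin N W K)
    (hK : IsImaginaryQuadratic K) (hD3 : NumberField.discr K ≠ -3)
    (hH : SatisfiesHeegnerHypothesis N K)
    (hopt : ∃ Dt : ModularParametrizationData W N,
      ∀ z ∈ Dt.L.lattice, ∃ w ∈ periodLattice Dt.f, z = (Dt.c : ℂ) * w)
    {P : (W.baseChange K).toAffine.Point} (hP : IsHeegnerPoint N W K P) (hnt : ¬ IsOfFinAddOrder P)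
    (hqN : q ∣ N) (hv : padicValNat p (AddSubgroup.zmultiples P).index ≤ w)
    (hr : W.analyticRank ≤ 1) {s : ℚ} (hs : shaAn W = (s : ℂ)) (hvs : padicValRat p s = 0) :
    BSDp W p := by
  subst hW
  have h0 : discOf [a1, a2, a3, a4, a6] ≠ 0 := fun h ↦ hpΔ (by rw [h]; exact dvd_zero _)
  haveI hE : (⟨a1, a2, a3, a4, a6⟩ : WeierstrassCurve ℚ).IsElliptic :=
    X11b.isElliptic_of_discOf_ne_zero a1 a2 a3 a4 a6 h0
  haveI := hmin
  haveI : Fact (Nat.Prime p) := ⟨hp⟩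
  haveI : Fact (Nat.Prime q) := ⟨hq⟩
  have hI0 : integralModelInt (⟨a1, a2, a3, a4, a6⟩ : WeierstrassCurve ℚ) = ⟨a1, a2, a3, a4, a6⟩ :=
    integralModelInt_eq_of_map_eq _ (map_mk_int a1 a2 a3 a4 a6)
  -- good reduction at `p` (minimal model, `p ∤ Δ`), hence `p ∤ N` for the level of the Heegner datum
  have hgood : (⟨a1, a2, a3, a4, a6⟩ : WeierstrassCurve ℚ).HasGoodReductionAtPrime p :=
    hasGoodReductionAtPrime_of_not_dvd _ p (by rw [minimalDiscriminantInt_eq hI0, intCurve_Δ]; exact hpΔ)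
  have hpN : ¬ p ∣ N := Supersingular.not_dvd_level_of_isHeegnerPoint_of_good _ p hP hgood
  -- the Tamagawa half in the kernel: `c_q(W/ℚ_q) = F.c`
  have hcq : ((⟨a1, a2, a3, a4, a6⟩ : WeierstrassCurve ℚ).baseChange ℚ_[q]).localTamagawaNumber ℤ_[q] =
      F.c :=
    Additive.IntModelTam.localTamagawaNumber_padic_eq_of_intModel_of_tamX hI0 q hFq hF
  have hI : padicValNat p (AddSubgroup.zmultiples P).index ≤
      padicValNat p (((⟨a1, a2, a3, a4, a6⟩ : WeierstrassCurve ℚ).baseChange ℚ_[q]).localTamagawaNumber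
        ℤ_[q]) := by
    rw [hcq]; exact hv.trans hw
  exact Supersingular.bsdp_of_jetchevTamagawaCertificate _ p hKo hJ hGZK hK hD3 hH hopt hP hnt hp2 hpN
    hρ q hqN hI hr hs hvs

/-- **`BSD(E,p)` at an odd prime `p` for a literal integer model from the two-engine HEEGNER-INDEX line
`p ∤ [E(K):ℤy_K]` (Kolyvagin 1990 as printed by McCallum 1991 §1 / Gross 1991 Prop. 2.1 (2)), `ρ̄_{E,p}` onto
SUPPLIED BY NAME.** Inputs (kernel) `Δ ≠ 0` (no minimality is needed on this line: `BSDp` and the consumer are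
model-invariant statements); (by name) `hρ`; (binders,
displayed) Kolyvagin's finiteness `hKo` and prime-by-prime bound `hB : Kolyvagin1990_padicValNat_card_sha_le N W K`
(PUBLISHED; NO hypothesis on the reduction of `E` at `p`), GZK `hGZK`, the Heegner datum (`K`, Heegner hypothesis
for `N`, `P = y_K` of infinite order), the INDEX LINE `hI : ¬ p ∣ [E(K):ℤP]`, `r_an ≤ 1`, `#Ш_an = s` with
`ord_p s = 0`. Output: the tree's class-agnostic consumer `Typed.bsdp_of_kolyvagin_of_not_dvd_index`. The D1
kit `JET.bsdp_of_d1IndexRow_unit_min` with the three Serre witnesses (and the minimality they needed) replaced by `hρ`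
and `5 ≤ p` by `p ≠ 2`. Per pair; no class statement; nothing about any particular curve is asserted.
[cite: McCallumLMS1991, §1 Theorem (Kolyvagin), p. 296] [cite: GrossLMS1991, §2 Prop. 2.1 (2)]
[cite: Miller2011LMS, §1 Def. 1.1, Thm. 4.1 and Cor. 4.8] -/
theorem bsdp_of_indexRow_unit_of_surj (p : ℕ) (hp : p.Prime) (hp2 : p ≠ 2) (a1 a2 a3 a4 a6 : ℤ)
    (h0 : discOf [a1, a2, a3, a4, a6] ≠ 0)
    (hρ : (⟨a1, a2, a3, a4, a6⟩ : WeierstrassCurve ℚ).HasSurjectiveModNGaloisRep p)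
    (hGZK : rank_eq_analyticRank_of_analyticRank_le_one)
    (W : WeierstrassCurve ℚ) (hW : W = ⟨a1, a2, a3, a4, a6⟩)
    {N : ℕ} [NeZero N] {K : Type} [Field K] [NumberField K] (hKo : kolyvagin N W K)
    (hB : Kolyvagin1990_padicValNat_card_sha_le N W K)
    (hK : IsImaginaryQuadratic K) (hH : SatisfiesHeegnerHypothesis N K)
    {P : (W.baseChange K).toAffine.Point} (hP : IsHeegnerPoint N W K P) (hnt : ¬ IsOfFinAddOrder P)
    (hI : ¬ p ∣ (AddSubgroup.zmultiples P).index)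
    (hr : W.analyticRank ≤ 1) {s : ℚ} (hs : shaAn W = (s : ℂ)) (hvs : padicValRat p s = 0) :
    BSDp W p := by
  subst hW
  haveI hE : (⟨a1, a2, a3, a4, a6⟩ : WeierstrassCurve ℚ).IsElliptic :=
    X11b.isElliptic_of_discOf_ne_zero a1 a2 a3 a4 a6 h0
  haveI : Fact (Nat.Prime p) := ⟨hp⟩
  exact bsdp_of_kolyvagin_of_not_dvd_index _ p hGZK hKo hB hK hH hP hnt hp2 hρ hI hr hs hvs

end Summit.BirchSwinnertonDyer.Rank1Residual.Supersingular.JetBySurj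

end
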